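import Mathlib.Algebra.BigOperators.Field
import Literature.Computability.AlgebraicComplexity.GenWordAutomaton
import HarnessLib

/-!
# Words with arbitrary letter sizes: imbalance, products over small parts, the greedy word

(N. Limaye, S. Srinivasan, S. Tavenas, J. ACM 72 (2025), Art. 26, §2.1 (Claim 7), §5 (proof of
Claim 16: "type 1 / type 2" factors), Lemma 13/15 (the greedy unbiased word); V. Bhargav,
P. Dutta, N. Saxena, ACM ToCT 16 (2024), Art. 22, §4.1, eq. (4.4)–(4.6): for their word the
imbalance of a small block set is LINEAR in its size, `|w_W| ≥ #W · κ`.)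

The general-word form of the imbalance section of `LowDepthRankBound.lean`, over
`GenWordDefs.lean`:

* `relRank_le_two_pow_wsum`: `relrk_{w|T}(f) ≤ 2^{-|w_T|/2}` (LST Claim 7(1) in word form), with
  `wsum_eq_sum_sub_sum`, `wsum_letterSize₂` (`w_T = #T⁺·kp - #T⁻·kn` for a two-letter word);
* `relRank_eq_zero_of_blockLinear`, `relRank_C_eq_zero` (leaves);
* **`relRank_prod_partition_le_of_law`**: for factors set-multilinear over pairwise disjoint
  parts, if every part of size `≥ θ` carries a factor of `relrk ≤ C` and every block set `W` with
  `#W < θ` satisfies the LAW `#W · κ ≤ |w_W|`, then the product has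
  `relrk ≤ max C 2^{-κ (∑ #parts)/2}` — the type-1/type-2 dichotomy of LST's Claim 16 with the
  imbalance law as a hypothesis (LST: `κ = k/(10 θ²)` from `√2 ∉ ℚ`; BDS: `κ = t c_m/(2 b_m)` from
  the continued fraction of `p₀/q₀`);
* `InL.mono`, `inL_opVal` for the induction class `InL`;
* the greedy sign pattern `greedyWord₂ d kp kn`: its prefix sums are `greedyAcc₂ ∈ [-kn, kp]`, so
  the word `(letterSize₂ kp kn w, w)` has every overhang `|w_{[t]}| ≤ max kp kn`
  (`overLen_greedy_le`).

## References

* N. Limaye, S. Srinivasan, S. Tavenas, J. ACM 72 (2025), Art. 26, Claim 7, Claim 16, Lemma 15.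
* V. Bhargav, P. Dutta, N. Saxena, ACM ToCT 16 (2024), Art. 22, §4.1.
-/

noncomputable section

open MvPolynomial

namespace Literature.Computability.AlgebraicComplexity

namespace GenWord

universe u

section Imbalance

variable {K : Type u} [Field K] {d : ℕ} (sz : Fin d → ℕ) (pos : Fin d → Bool)

/-! ### Imbalance in terms of the word -/

/-- The size of a block of variables: `|X i| = 2^{|w_i|}`.
[cite: LimayeSrinivasanTavenas2025, §2] -/
theorem card_blockVar (i : Fin d) : Fintype.card (BlockVar sz i) = 2 ^ sz i := by
  rw [Fintype.card_fun, Fintype.card_bool, Fintype.card_fin]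

/-- `|M^P|` over the blocks `T`: `∏_{i ∈ T⁺} |X i| = 2^{∑_{i ∈ T⁺} |w_i|}`.
[cite: LimayeSrinivasanTavenas2025, §2.1] -/
theorem prod_card_filter_pos (T : Finset (Fin d)) :
    (∏ i ∈ T.filter (fun i => pos i), (Fintype.card (BlockVar sz i) : ℝ)) =
      (2 : ℝ) ^ (∑ i ∈ T.filter (fun i => pos i), sz i) := by
  rw [Finset.prod_congr rfl fun i _ => by rw [card_blockVar, Nat.cast_pow, Nat.cast_ofNat],
    Finset.prod_pow_eq_pow_sum]

/-- `|M^N|` over the blocks `T`: `∏_{i ∈ T⁻} |X i| = 2^{∑_{i ∈ T⁻} |w_i|}`.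
[cite: LimayeSrinivasanTavenas2025, §2.1] -/
theorem prod_card_filter_neg (T : Finset (Fin d)) :
    (∏ i ∈ T.filter (fun i => !pos i), (Fintype.card (BlockVar sz i) : ℝ)) =
      (2 : ℝ) ^ (∑ i ∈ T.filter (fun i => !pos i), sz i) := by
  rw [Finset.prod_congr rfl fun i _ => by rw [card_blockVar, Nat.cast_pow, Nat.cast_ofNat],
    Finset.prod_pow_eq_pow_sum]

/-- `w_T` splits as (positive letters) minus (negative letters).
[cite: LimayeSrinivasanTavenas2025, Claim 16] -/
theorem wsum_eq_sum_sub_sum (T : Finset (Fin d)) :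
    wsum sz pos T = ((∑ i ∈ T.filter (fun i => pos i), sz i : ℕ) : ℤ) -
      ((∑ i ∈ T.filter (fun i => !pos i), sz i : ℕ) : ℤ) := by
  unfold wsum
  rw [← Finset.sum_filter_add_sum_filter_not T (fun i => pos i = true)]
  have h1 : ∑ i ∈ T.filter (fun i => pos i = true), wt sz pos i =
      ((∑ i ∈ T.filter (fun i => pos i), sz i : ℕ) : ℤ) := by
    rw [Nat.cast_sum]
    refine Finset.sum_congr rfl fun i hi => ?_
    rw [Finset.mem_filter] at hi
    simp [wt, hi.2]
  have h2 : ∑ i ∈ T.filter (fun i => ¬ pos i = true), wt sz pos i =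
      -(((∑ i ∈ T.filter (fun i => !pos i), sz i : ℕ) : ℤ)) := by
    have hf : T.filter (fun i => ¬ pos i = true) = T.filter (fun i => !pos i) := by
      ext i; simp
    rw [hf, Nat.cast_sum, ← Finset.sum_neg_distrib]
    refine Finset.sum_congr rfl fun i hi => ?_
    rw [Finset.mem_filter] at hi
    have : ¬ pos i = true := by simpa using hi.2
    simp [wt, this]
  rw [h1, h2]
  ring

/-- For a two-letter word, `w_T = #T⁺ · kp - #T⁻ · kn`. [cite: BhargavDuttaSaxena2024, §4.1] -/
theorem wsum_letterSize₂ (kp kn : ℕ) (T : Finset (Fin d)) :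
    wsum (letterSize₂ kp kn pos) pos T =
      ((T.filter fun i => pos i).card : ℤ) * kp - ((T.filter fun i => !pos i).card : ℤ) * kn := by
  rw [wsum_eq_sum_sub_sum]
  have h1 : ∑ i ∈ T.filter (fun i => pos i), letterSize₂ kp kn pos i =
      (T.filter fun i => pos i).card * kp := by
    rw [Finset.sum_congr rfl (g := fun _ => kp), Finset.sum_const, smul_eq_mul]
    intro i hi
    rw [Finset.mem_filter] at hi
    simp [letterSize₂, hi.2]
  have h2 : ∑ i ∈ T.filter (fun i => !pos i), letterSize₂ kp kn pos i =
      (T.filter fun i => !pos i).card * kn := by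
    rw [Finset.sum_congr rfl (g := fun _ => kn), Finset.sum_const, smul_eq_mul]
    intro i hi
    rw [Finset.mem_filter] at hi
    have : ¬ pos i = true := by simpa using hi.2
    simp [letterSize₂, this]
  rw [h1, h2]
  push_cast
  ring

/-- **Imbalance** (LST 2025, Claim 7(1) in word form): `relrk_{w|T}(f) ≤ 2^{-|w_T|/2}` for
every `f` and every block set `T`. [cite: LimayeSrinivasanTavenas2025, Claim 7] -/
theorem relRank_le_two_pow_wsum (T : Finset (Fin d)) (f : MvPolynomial (Σ i, BlockVar sz i) K) :
    relRank K pos T f ≤ (2 : ℝ) ^ (-(|(wsum sz pos T : ℝ)|) / 2) := by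
  have h2 : (0 : ℝ) < 2 := by norm_num
  set p := ∑ i ∈ T.filter (fun i => pos i), sz i
  set q := ∑ i ∈ T.filter (fun i => !pos i), sz i
  have hw : (wsum sz pos T : ℝ) = p - q := by
    rw [wsum_eq_sum_sub_sum]; simp only [Int.cast_sub, Int.cast_natCast, p, q]
  have hR := prod_card_filter_pos sz pos T
  have hC := prod_card_filter_neg sz pos T
  have hpow : (2 : ℝ) ^ p / (2 : ℝ) ^ q = (2 : ℝ) ^ (wsum sz pos T : ℝ) := by
    rw [hw, Real.rpow_sub h2, Real.rpow_natCast, Real.rpow_natCast]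
  have hsqrt : ∀ x : ℝ, Real.sqrt ((2 : ℝ) ^ x) = (2 : ℝ) ^ (x / 2) := fun x => by
    rw [Real.sqrt_eq_rpow, ← Real.rpow_mul h2.le]
    congr 1; ring
  by_cases hsign : (0 : ℝ) ≤ (wsum sz pos T : ℝ)
  · have h := relRank_le_sqrt_div' (K := K) pos T f
    rw [hR, hC] at h
    have hinv : (2 : ℝ) ^ q / (2 : ℝ) ^ p = (2 : ℝ) ^ (-(wsum sz pos T : ℝ)) := by
      rw [Real.rpow_neg h2.le, ← hpow, inv_div]
    rw [hinv, hsqrt] at h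
    rw [abs_of_nonneg hsign]
    exact h
  · have h := relRank_le_sqrt_div (K := K) pos T f
    rw [hR, hC, hpow, hsqrt] at h
    rw [abs_of_neg (not_le.1 hsign), neg_neg]
    exact h

/-- A block-linear form has `relrk = 0` over every block set but its own block.
[cite: LimayeSrinivasanTavenas2025, §2.1] -/
theorem relRank_eq_zero_of_blockLinear {f : MvPolynomial (Σ i, BlockVar sz i) K} {b : Fin d}
    (hf : IsWeightedHomogeneous (blockWeight Sigma.fst) f (Finsupp.single b 1))
    {T : Finset (Fin d)} (hT : T ≠ {b}) : relRank K pos T f = 0 := by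
  refine relRank_eq_zero_of_isSetMultilinear pos ?_ hT
  unfold IsSetMultilinear
  rwa [blockProfile_singleton]

/-- Constants have `relrk = 0` over every nonempty block set.
[cite: LimayeSrinivasanTavenas2025, §2.1] -/
theorem relRank_C_eq_zero (c : K) {T : Finset (Fin d)} (hT : T.Nonempty) :
    relRank K pos T (C c : MvPolynomial (Σ i, BlockVar sz i) K) = 0 :=
  relRank_eq_zero_of_isSetMultilinear pos (isSetMultilinear_C Sigma.fst c)
    (Finset.nonempty_iff_ne_empty.1 hT)

/-! ### Products over small parts, under a linear imbalance law -/

/-- **Products over small parts** (the "type 2" case of LST 2025, proof of Claim 16, with the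
imbalance law as a hypothesis): if every part satisfies `#W x · κ ≤ |w_{W x}|` then
`∏_x 2^{-|w_{W x}|/2} ≤ 2^{-κ (∑_x #W x)/2}`. [cite: LimayeSrinivasanTavenas2025, Claim 16] -/
theorem prod_two_pow_wsum_le_of_law {ι' : Type*} (s : Finset ι') (W : ι' → Finset (Fin d))
    {κ : ℝ} (hlaw : ∀ x ∈ s, ((W x).card : ℝ) * κ ≤ |(wsum sz pos (W x) : ℝ)|) :
    ∏ x ∈ s, (2 : ℝ) ^ (-(|(wsum sz pos (W x) : ℝ)|) / 2) ≤
      (2 : ℝ) ^ (-κ * (∑ x ∈ s, ((W x).card : ℝ)) / 2) := by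
  have h2 : (0 : ℝ) < 2 := by norm_num
  have hrhs : (2 : ℝ) ^ (-κ * (∑ x ∈ s, ((W x).card : ℝ)) / 2) =
      ∏ x ∈ s, (2 : ℝ) ^ (-κ * ((W x).card : ℝ) / 2) := by
    rw [← Real.rpow_sum_of_pos h2]
    congr 1
    rw [Finset.mul_sum, Finset.sum_div]
  rw [hrhs]
  refine Finset.prod_le_prod (fun x _ => by positivity) fun x hx => ?_
  refine Real.rpow_le_rpow_of_exponent_le (by norm_num) ?_
  have hmain := hlaw x hx
  have : -κ * ((W x).card : ℝ) / 2 = -(((W x).card : ℝ) * κ / 2) := by ring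
  rw [this]
  linarith

/-- **Products over a labelled partition with a threshold and a law** (the type-1/type-2
dichotomy of LST 2025, proof of Claim 16): if the factors are set-multilinear over pairwise
disjoint parts, every factor on a part of size `≥ θ` has `relrk ≤ C`, and every block set `W`
with `#W < θ` obeys `#W · κ ≤ |w_W|`, then the product has `relrk ≤ max C 2^{-κ (∑ #parts)/2}`.
[cite: LimayeSrinivasanTavenas2025, Claim 16] -/
theorem relRank_prod_partition_le_of_law {ι' : Type*} [Fintype ι'] [DecidableEq ι']
    (Part : ι' → Finset (Fin d)) (Fac : ι' → MvPolynomial (Σ i : Fin d, BlockVar sz i) K)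
    (hdisj : ((Finset.univ : Finset ι') : Set ι').PairwiseDisjoint Part)
    (hsml : ∀ x, IsSetMultilinear Sigma.fst (Part x) (Fac x))
    {θ C κ : ℝ}
    (hlaw : ∀ W : Finset (Fin d), (W.card : ℝ) < θ → (W.card : ℝ) * κ ≤ |(wsum sz pos W : ℝ)|)
    (hbig : ∀ x, θ ≤ ((Part x).card : ℝ) → relRank K pos (Part x) (Fac x) ≤ C) :
    relRank K pos (Finset.univ.biUnion Part) (∏ x, Fac x) ≤
      max C ((2 : ℝ) ^ (-κ * (∑ x, ((Part x).card : ℝ)) / 2)) := by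
  rw [relRank_finset_prod pos Finset.univ Part Fac hdisj (fun x _ => hsml x)]
  have h0 : ∀ x, 0 ≤ relRank K pos (Part x) (Fac x) := fun x => relRank_nonneg pos _ _
  have h1 : ∀ x, relRank K pos (Part x) (Fac x) ≤ 1 := fun x => relRank_le_one pos _ _
  by_cases hbigx : ∃ x, θ ≤ ((Part x).card : ℝ)
  · obtain ⟨x, hx⟩ := hbigx
    refine le_trans ?_ (le_max_left _ _)
    calc ∏ y, relRank K pos (Part y) (Fac y)
        = relRank K pos (Part x) (Fac x) * ∏ y ∈ Finset.univ.erase x, relRank K pos (Part y) (Fac y) :=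
          (Finset.mul_prod_erase _ _ (Finset.mem_univ x)).symm
      _ ≤ relRank K pos (Part x) (Fac x) * 1 :=
          mul_le_mul_of_nonneg_left (Finset.prod_le_one (fun y _ => h0 y) fun y _ => h1 y) (h0 x)
      _ ≤ C := by rw [mul_one]; exact hbig x hx
  · push Not at hbigx
    refine le_trans ?_ (le_max_right _ _)
    calc ∏ y, relRank K pos (Part y) (Fac y)
        ≤ ∏ y, (2 : ℝ) ^ (-(|(wsum sz pos (Part y) : ℝ)|) / 2) :=
          Finset.prod_le_prod (fun y _ => h0 y) fun y _ => relRank_le_two_pow_wsum sz pos _ _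
      _ ≤ _ := prod_two_pow_wsum_le_of_law sz pos Finset.univ Part fun y _ => hlaw _ (hbigx y)

end Imbalance

/-! ### The induction class -/

section Induction

variable {K : Type u} [CommSemiring K] {σ τ : Type*}
variable {g : σ → MvPolynomial τ K} {P : ArithCircuit K σ}

/-- Levels are monotone. [cite: LimayeSrinivasanTavenas2025, Claim 16] -/
theorem InL.mono {p p' : ℕ} (h : p ≤ p') {x : MvPolynomial τ K} (hx : InL g P p x) :
    InL g P p' x := by
  rcases hx with ⟨j, hj, rfl⟩ | hx
  · exact Or.inl ⟨j, hj.trans h, rfl⟩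
  · exact Or.inr hx

variable (g P)

/-- The value of an operand of gate `j` is of level `opPD` (a gate of that product-depth, a
variable image, or a constant). [cite: LimayeSrinivasanTavenas2025, Claim 16] -/
theorem inL_opVal (j : ℕ) (u : ArithCircuit.Operand K σ) :
    InL g P (P.opPD j u) (aeval g (P.opVal j u)) := by
  cases u with
  | var v => exact Or.inr (Or.inl ⟨v, by simp⟩)
  | const c => exact Or.inr (Or.inr ⟨c, by simp [MvPolynomial.algebraMap_eq]⟩)
  | gate j' =>
    simp only [ArithCircuit.opVal_gate, ArithCircuit.opPD_gate]
    split_ifs with h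
    · exact Or.inl ⟨j', le_rfl, rfl⟩
    · exact Or.inr (Or.inr ⟨0, by simp⟩)

end Induction

/-! ### The greedy word over two letters -/

section Greedy

/-- Unfolding the greedy prefix sum at `0`. [cite: LimayeSrinivasanTavenas2025, Lemma 15] -/
@[simp]
theorem greedyAcc₂_zero (kp kn : ℕ) : greedyAcc₂ kp kn 0 = 0 := rfl

/-- Unfolding the greedy prefix sum one step. [cite: LimayeSrinivasanTavenas2025, Lemma 15] -/
theorem greedyAcc₂_succ (kp kn t : ℕ) :
    greedyAcc₂ kp kn (t + 1) =
      greedyAcc₂ kp kn t + (if greedyAcc₂ kp kn t ≤ 0 then (kp : ℤ) else -(kn : ℤ)) :=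
  rfl

/-- The prefix sums of the greedy word stay in `[-kn, kp]`.
[cite: LimayeSrinivasanTavenas2025, Lemma 15] -/
theorem greedyAcc₂_mem (kp kn t : ℕ) :
    -(kn : ℤ) ≤ greedyAcc₂ kp kn t ∧ greedyAcc₂ kp kn t ≤ kp := by
  induction t with
  | zero => simp
  | succ t ih =>
    rw [greedyAcc₂_succ]
    split_ifs with h
    · constructor <;> omega
    · constructor <;> omega

/-- Prefix sums of the greedy word are the running sums `greedyAcc₂`.
[cite: LimayeSrinivasanTavenas2025, Lemma 15] -/
theorem wsum_greedy_prefix (d kp kn t : ℕ) (ht : t ≤ d) :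
    wsum (letterSize₂ kp kn (greedyWord₂ d kp kn)) (greedyWord₂ d kp kn)
      (Finset.univ.filter fun i : Fin d => (i : ℕ) < t) = greedyAcc₂ kp kn t := by
  induction t with
  | zero => simp [wsum]
  | succ t ih =>
    have ht' : t < d := Nat.lt_of_succ_le ht
    have hsplit : (Finset.univ.filter fun i : Fin d => (i : ℕ) < t + 1) =
        insert ⟨t, ht'⟩ (Finset.univ.filter fun i : Fin d => (i : ℕ) < t) := by
      ext i
      simp only [Finset.mem_filter, Finset.mem_univ, true_and, Finset.mem_insert, Fin.ext_iff]
      omega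
    have hnot : (⟨t, ht'⟩ : Fin d) ∉ (Finset.univ.filter fun i : Fin d => (i : ℕ) < t) := by
      simp
    rw [wsum, hsplit, Finset.sum_insert hnot, ← wsum, ih ht'.le, greedyAcc₂_succ, add_comm]
    congr 1
    by_cases h : greedyAcc₂ kp kn t ≤ 0
    · simp [wt, letterSize₂, greedyWord₂, h]
    · simp [wt, letterSize₂, greedyWord₂, h]

/-- **The greedy word is `max kp kn`-unbiased**: `|w_{[t]}| ≤ max kp kn` for every `t ≤ d`
(LST 2025, proof of Lemma 15: "we can fix a word `w` over the alphabet `{⌊αk⌋, -k}` such that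
`w` is `k`-unbiased"; BDS 2024, §4.1: the word over `{αk, -k}`).
[cite: LimayeSrinivasanTavenas2025, Lemma 15] -/
theorem abs_prefixSum_greedy_le (d kp kn t : ℕ) (ht : t ≤ d) :
    |wsum (letterSize₂ kp kn (greedyWord₂ d kp kn)) (greedyWord₂ d kp kn)
      (Finset.univ.filter fun i : Fin d => (i : ℕ) < t)| ≤ max kp kn := by
  rw [wsum_greedy_prefix d kp kn t ht, abs_le]
  have h := greedyAcc₂_mem kp kn t
  have h1 : (kp : ℤ) ≤ max kp kn := by exact_mod_cast le_max_left kp kn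
  have h2 : (kn : ℤ) ≤ max kp kn := by exact_mod_cast le_max_right kp kn
  push_cast
  constructor <;> omega

/-- Every overhang of the greedy word has length `≤ max kp kn` (the automaton for its word
polynomial has width `≤ 2^{max kp kn}`). [cite: LimayeSrinivasanTavenas2025, Lemma 22] -/
theorem overLen_greedy_le (d kp kn t : ℕ) :
    overLen (letterSize₂ kp kn (greedyWord₂ d kp kn)) (greedyWord₂ d kp kn) t ≤ max kp kn := by
  wlog ht : t ≤ d generalizing t
  · rw [overLen_of_le _ _ (le_of_not_ge ht)]; exact this d le_rfl
  rw [overLen_eq_natAbs _ _ t ht]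
  have h := abs_prefixSum_greedy_le d kp kn t ht
  have h' := (greedyAcc₂_mem kp kn t)
  rw [wsum_greedy_prefix d kp kn t ht] at h ⊢
  omega

end Greedy

end GenWord

end Literature.Computability.AlgebraicComplexity
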